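import Summits.HodgeConjecture.HodgeConjecture.Theorems.CyclicUnitaryPowersVeryGeneralDeckCommutatorsInHg
import Literature.AlgebraicGeometry.HodgeTheory.GoursatKolchinRibetDischarge
import HarnessLib

/-!
# Crux K1 `VeryGeneralDeckCommutatorsInHg` (route `CyclicUnitaryPowers`, stmt-HodgeConjecture-19544): the fact binder
# `stub_katzGKR` LANDED as a theorem; K1 modulo its six geometric / Hodge-II facts

The registered skeleton v9 of the crux (`Cruxes/VeryGeneralDeckCommutatorsInHg/Lines/unitary-reflection-zariski`, planner
P3 g23) binds the Goursat–Kolchin–Ribet criterion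
`Literature.AlgebraicGeometry.HodgeTheory.Katz1990_goursatKolchinRibet_specialLinear'` (Katz 1990, Prop. 1.8.2, special
case `Gᵢ^{0,der} = SL(Vᵢ)`, on `ℂ`-points) as the stub `stub_katzGKR`. That fact is now a THEOREM of the tree
(`Literature/AlgebraicGeometry/HodgeTheory/GoursatKolchinRibetDischarge.lean`,
`Katz1990_goursatKolchinRibet_specialLinear'_holds`: Katz's proof formalised over the tree's algebraic-group library —
`GoursatKolchinRibetKernels` / `…Projections` / `…LieAlgebra` / `…LieCore` / `…Holds` (prover-Ax) with the classification
of `Aut 𝔰𝔩ₙ` `Jacobson1962_sl_automorphisms_holds` (prover-Bx)). This file records the stub BY NAME and signature, so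
the binder expires from the crux's registry, and re-derives the crux from the SIX remaining cited facts
(Carlson–Toledo ×4, Cattani–Deligne–Kaplan, André). Written by the prover seat `hodge-nonav-prover-Ax` (g3).
Nothing here says HC ∕ HC_AV is proved; rung F-H1 not moved.

## References
* [Katz1990ESDE] N. M. Katz, Ann. of Math. Stud. 124 (1990), §1.8 Prop. 1.8.2.
* [Jacobson1962LieAlgebras] N. Jacobson, *Lie Algebras* (1962), Ch. IX §5 Theorem 5.
* [CarlsonToledo1999] J. A. Carlson, D. Toledo, Duke Math. J. 97 (1999), Theorem 7.1.
-/

noncomputable section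

open Literature.AlgebraicGeometry.Motives Literature.AlgebraicGeometry.HodgeTheory

-- mandated namespace `Summit.HodgeConjecture.HodgeConjecture.Theorems` trips `linter.dupNamespace` (off tree-wide)
set_option linter.dupNamespace false

namespace Summit.HodgeConjecture.HodgeConjecture.Theorems.CyclicUnitaryPowersKatzGKR

/-- **Stub `stub_katzGKR` of line `unitary-reflection-zariski` (v9) of crux K1 `VeryGeneralDeckCommutatorsInHg`,
PROVED**: the Goursat–Kolchin–Ribet criterion `Katz1990_goursatKolchinRibet_specialLinear'` holds
(`Katz1990_goursatKolchinRibet_specialLinear'_holds`). [cite: Katz1990ESDE, §1.8 Prop. 1.8.2]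
[cite: Jacobson1962LieAlgebras, Ch. IX §5 Theorem 5 (p. 283)] -/
theorem stub_katzGKR : Literature.AlgebraicGeometry.HodgeTheory.Katz1990_goursatKolchinRibet_specialLinear' :=
  Literature.AlgebraicGeometry.HodgeTheory.Katz1990_goursatKolchinRibet_specialLinear'_holds

/-- **Crux K1 `VeryGeneralDeckCommutatorsInHg` modulo its SIX geometric / Hodge-II cited facts** (Carlson–Toledo 1999:
the family, the invariant line, the eigenspace Hodge numbers, the unitary-reflection density; Cattani–Deligne–Kaplan 1995;
André 1992) — the Katz fact of `CyclicUnitaryPowersVeryGeneralDeckCommutatorsInHg.veryGeneralDeckCommutatorsInHg_of_facts`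
being now the theorem `stub_katzGKR`. [cite: CarlsonToledo1999, §7 Theorem 7.1 (p. 16)] [cite: Katz1990ESDE, §1.8 Prop. 1.8.2] -/
theorem veryGeneralDeckCommutatorsInHg_of_six_facts
    (hCT : nonempty_carlsonToledoFamily) (hCT1 : carlsonToledo1999_finrank_eigenspace_deck_one)
    (hCT2 : carlsonToledo1999_finrank_eigenspace_inf_hodgePiece)
    (hCDK : cmsp_nonHodgeGenericPoints_countable_algebraic_cover)
    (hAndre : andre1992_algebraicMonodromy_normal_mumfordTateGroup)
    (hCTd : carlsonToledo1999_unitaryReflection_zariskiDense) :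
    Summit.HodgeConjecture.HodgeConjecture.Theses.CyclicUnitaryPowers.VeryGeneralDeckCommutatorsInHg :=
  CyclicUnitaryPowersVeryGeneralDeckCommutatorsInHg.veryGeneralDeckCommutatorsInHg_of_facts @hCT @hCT1 @hCT2 @hCDK
    @hAndre @hCTd @stub_katzGKR

end Summit.HodgeConjecture.HodgeConjecture.Theorems.CyclicUnitaryPowersKatzGKR

end
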